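import Literature.NumberTheory.Weil1964.RealWeilIndexSeveralVariables
import Mathlib.Analysis.Matrix.Spectrum
import Mathlib.LinearAlgebra.UnitaryGroup
import Mathlib.MeasureTheory.Measure.Lebesgue.Complex
import HarnessLib

/-!
# Weil's index of a real quadratic form: equivalent forms, symmetric Gram matrices, the complex place

Topic `NumberTheory/Weil1964`; namespace `Literature.NumberTheory.Weil1964`. KERNEL mathematics only
(three definitions with bodies + theorems; no named fact, no `axiom`, no `sorry`). Sequel of
`RealWeilIndexSeveralVariables.lean` (index `realWeilIndexPi c = ∏ γ(e^{2πi cᵢ x²})` of a DIAGONAL real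
form, with Weil's Théorème 2 / Corollaire 2 for `G = ℝ^ι` proved), discharging its `TODO(general form)`.

* §1 **Equivalent forms** ([Weil1964, Chap. II n° 25 p. 173]: "si `f' = f ∘ α`, où `α` est un isomorphisme
  ... on a `γ(f') = γ(f)`; en d'autres termes, `γ` a même valeur pour deux formes équivalentes"):
  Corollaire 2 for `f ∘ A`, `A ∈ GL(ℝ^ι)` — `∫∫ Φ(u) f(A(x - u)) du dx = γ(f) |det A|⁻¹ ∏|2cᵢ|^{-1/2} ∫ Φ`
  (`weil_corollary2_pi_comp_linearEquiv`; the module is `|ρ_{f∘A}|^{-1/2}`, `ρ_{f∘A} = Aᵀ ρ A`), by the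
  linear change of variables `∫ F(Ax) dx = |det A|⁻¹ ∫ F` in both variables; and the uniqueness statement
  `γ(f ∘ A) = γ(f)` (`realWeilIndexPi_comp_linearEquiv_unique`).
* §2 **Symmetric Gram matrices** ([Weil1964, Chap. II n° 26 p. 173]: over `k = R` "toute forme quadratique non
  dégénérée est équivalente à une forme `q_a(x) - q_b(y)` ... si `f` a le type d'inertie `(a, b)`,
  `γ(f) = γ(q₁)^{a-b}`"): the character `symmChirp S x = e^{2πi xᵀ S x}` of an invertible symmetric `S` is
  `f_{diag λ} ∘ Uᵀ` for Mathlib's orthogonal diagonalisation `S = U diag(λ) Uᵀ`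
  (`Matrix.IsHermitian.spectral_theorem`), so `realWeilIndexSymm hS := ∏ γ(e^{2πi λᵢ x²}) = γ(q₁)^a (γ(q₁)⁻¹)^b`
  satisfies Corollaire 2 with the module `|det 2S|^{-1/2}` (`weil_corollary2_symm`) and is determined by it
  (`realWeilIndexSymm_unique`, hence independent of the eigenbasis).
* §3 **The complex place** ([Weil1964, Chap. II n° 26 p. 174]): for `k = C`, `χ(z) = χ₀(λz + λ̄z̄)` and the
  form `c z²`, the real form `2 Re(μ z²)` (`μ = λ c ≠ 0`) on `R² = C` has Gram matrix
  `complexPlaceGram μ = [[2 Re μ, -2 Im μ], [-2 Im μ, -2 Re μ]]` of determinant `-4|μ|² < 0`, inertia `(1,1)`,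
  hence index `1` (`realWeilIndexSymm_complexPlaceGram`): "Il en est donc de même pour toute forme quadratique
  non dégénérée sur `C`."
* §4 the same statement ON `C` with its Lebesgue measure (`weil_corollary2_complexPlace`): for every
  `Φ ∈ 𝓢(C)`, `∫∫ Φ(u) e^{4πi Re(μ (z-u)²)} du dz = (4|μ|)⁻¹ ∫ Φ` — Corollaire 2 with the POSITIVE scalar
  `|ρ|^{-1/2}` and no phase, i.e. `γ = 1`, transported along `C = R²` (`Complex.volume_preserving_equiv_pi`).

## References

* [Weil1964] A. Weil, *Sur certains groupes d'opérateurs unitaires*, Acta Math. 111 (1964) 143–211: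
  Chap. I n° 14 Théorème 2, Corollaire 2 (pp. 161–162); Chap. II n° 25 (p. 173, equivalent forms, Prop. 3),
  n° 26 (pp. 173–174: `k = R`, type d'inertie; `k = C`, `γ(f) = 1`).
-/

set_option autoImplicit false

noncomputable section

open MeasureTheory Complex Filter Topology Set Finset
open scoped Real FourierTransform SchwartzMap BigOperators ComplexConjugate Matrix

namespace Literature.NumberTheory.Weil1964

variable {ι : Type*} [Fintype ι]

/-! ## §1 Equivalent forms: linear changes of variables ([Weil1964, Chap. II n° 25, p. 173]) -/

/-- **linear change of variables** in `ℝ^ι`: `∫ F(A x) dx = |det A|⁻¹ ∫ F` for an automorphism `A`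
(the module of `A` for Lebesgue measure). [folklore] -/
private theorem integral_comp_linearEquiv_pi {E : Type*} [NormedAddCommGroup E] [NormedSpace ℝ E]
    (A : (ι → ℝ) ≃ₗ[ℝ] (ι → ℝ)) (F : (ι → ℝ) → E) :
    ∫ x : ι → ℝ, F (A x) = |LinearMap.det (A : (ι → ℝ) →ₗ[ℝ] (ι → ℝ))|⁻¹ • ∫ y : ι → ℝ, F y := by
  set em : (ι → ℝ) ≃ᵐ (ι → ℝ) := A.toContinuousLinearEquiv.toHomeomorph.toMeasurableEquiv with hem
  have hcoe : (em : (ι → ℝ) → (ι → ℝ)) = ((A : (ι → ℝ) →ₗ[ℝ] (ι → ℝ)) : (ι → ℝ) → (ι → ℝ)) := rfl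
  have hne : LinearMap.det (A : (ι → ℝ) →ₗ[ℝ] (ι → ℝ)) ≠ 0 := A.isUnit_det'.ne_zero
  calc ∫ x : ι → ℝ, F (A x) = ∫ x : ι → ℝ, F (em x) := rfl
    _ = ∫ y, F y ∂(Measure.map em volume) := (integral_map_equiv em F).symm
    _ = ∫ y, F y ∂(ENNReal.ofReal |(LinearMap.det (A : (ι → ℝ) →ₗ[ℝ] (ι → ℝ)))⁻¹| •
          (volume : Measure (ι → ℝ))) := by
        rw [hcoe, Real.map_linearMap_volume_pi_eq_smul_volume_pi hne]
    _ = |LinearMap.det (A : (ι → ℝ) →ₗ[ℝ] (ι → ℝ))|⁻¹ • ∫ y : ι → ℝ, F y := by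
        rw [integral_smul_measure, ENNReal.toReal_ofReal (abs_nonneg _), abs_inv]

/-- **equivalent forms** ("`γ` a même valeur pour deux formes équivalentes `f`, `f' = f ∘ α`"):
Corollaire 2 for the second-degree character `f ∘ A` of the quadratic form `q ∘ A`, `A ∈ GL(ℝ^ι)`,
`q = ∑ cᵢ xᵢ²` — the scalar is still `γ(f) = ∏ γ(e^{2πi cᵢ x²})`, and the module factor becomes
`|ρ_{f∘A}|^{-1/2} = |det A|⁻¹ ∏ |2cᵢ|^{-1/2}` (`ρ_{f∘A} = Aᵀ ρ A`). Every non-degenerate real quadratic form is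
of this shape (n° 26). [cite: Weil1964, Chap. II n° 25, p. 173; Chap. I n° 14 Cor. 2, p. 162] -/
theorem weil_corollary2_pi_comp_linearEquiv {c : ι → ℝ} (hc : ∀ i, c i ≠ 0)
    (A : (ι → ℝ) ≃ₗ[ℝ] (ι → ℝ)) (Φ : 𝓢((ι → ℝ), ℂ)) :
    ∫ x : ι → ℝ, ∫ u : ι → ℝ, Φ u * realChirpPi c (A (x - u)) =
      realWeilIndexPi c * ((∏ i, |2 * c i| ^ (-(1 / 2 : ℝ)) : ℝ) : ℂ) *
        ((|LinearMap.det (A : (ι → ℝ) →ₗ[ℝ] (ι → ℝ))|⁻¹ : ℝ) : ℂ) * ∫ x : ι → ℝ, Φ x := by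
  set d : ℝ := LinearMap.det (A : (ι → ℝ) →ₗ[ℝ] (ι → ℝ)) with hd
  have hdne : d ≠ 0 := A.isUnit_det'.ne_zero
  have hdabs : 0 < |d| := abs_pos.2 hdne
  -- `Ψ = Φ ∘ A⁻¹ ∈ 𝓢(ℝ^ι)`
  set Ψ : 𝓢((ι → ℝ), ℂ) :=
    SchwartzMap.compCLMOfContinuousLinearEquiv ℂ A.symm.toContinuousLinearEquiv Φ with hΨ
  have hΨ_apply : ∀ w, Ψ w = Φ (A.symm w) := fun w => rfl
  -- inner integrals: `u = A⁻¹ w`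
  have hinner : ∀ x : ι → ℝ, ∫ u, Φ u * realChirpPi c (A (x - u)) =
      |d|⁻¹ • ∫ w, Ψ w * realChirpPi c (A x - w) := by
    intro x
    have h := integral_comp_linearEquiv_pi A (fun w => Ψ w * realChirpPi c (A x - w))
    rw [← hd] at h
    rw [← h]
    congr 1
    funext u
    rw [hΨ_apply, LinearEquiv.symm_apply_apply, map_sub]
  simp_rw [hinner]
  rw [integral_smul]
  -- outer integral: `x = A⁻¹ y`
  have houter := integral_comp_linearEquiv_pi A (fun y => ∫ w, Ψ w * realChirpPi c (y - w))
  rw [← hd] at houter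
  rw [houter, weil_corollary2_pi hc Ψ]
  -- `∫ Ψ = |det A| ∫ Φ`
  have hΨint : ∫ y, Ψ y = |d| • ∫ x, Φ x := by
    simp_rw [hΨ_apply]
    rw [integral_comp_linearEquiv_pi A.symm (fun x => Φ x), LinearEquiv.det_coe_symm, ← hd, abs_inv,
      inv_inv]
  rw [hΨint, Complex.real_smul, Complex.real_smul, Complex.real_smul]
  -- constants
  have hdC : ((|d| : ℝ) : ℂ) ≠ 0 := Complex.ofReal_ne_zero.2 hdabs.ne'
  push_cast
  field_simp

/-- **`γ(f ∘ A) = γ(f)`** as a uniqueness statement: the scalar in Corollaire 2 for `f ∘ A` (normalised by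
the module `|ρ_{f∘A}|^{-1/2}`) is `γ(f)`, for any single Schwartz `Φ` with `∫ Φ ≠ 0`.
[cite: Weil1964, Chap. II n° 25, p. 173] -/
theorem realWeilIndexPi_comp_linearEquiv_unique {c : ι → ℝ} (hc : ∀ i, c i ≠ 0)
    (A : (ι → ℝ) ≃ₗ[ℝ] (ι → ℝ)) {γ : ℂ} (Φ : 𝓢((ι → ℝ), ℂ)) (hΦ : ∫ x, Φ x ≠ 0)
    (h : ∫ x : ι → ℝ, ∫ u : ι → ℝ, Φ u * realChirpPi c (A (x - u)) =
      γ * ((∏ i, |2 * c i| ^ (-(1 / 2 : ℝ)) : ℝ) : ℂ) *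
        ((|LinearMap.det (A : (ι → ℝ) →ₗ[ℝ] (ι → ℝ))|⁻¹ : ℝ) : ℂ) * ∫ x, Φ x) :
    γ = realWeilIndexPi c := by
  rw [weil_corollary2_pi_comp_linearEquiv hc A Φ] at h
  have hne : ((∏ i, |2 * c i| ^ (-(1 / 2 : ℝ)) : ℝ) : ℂ) ≠ 0 := by
    exact_mod_cast (Finset.prod_pos fun i _ =>
      Real.rpow_pos_of_pos (abs_pos.2 (mul_ne_zero two_ne_zero (hc i))) _).ne'
  have hne' : ((|LinearMap.det (A : (ι → ℝ) →ₗ[ℝ] (ι → ℝ))|⁻¹ : ℝ) : ℂ) ≠ 0 := by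
    exact_mod_cast (inv_pos.2 (abs_pos.2 A.isUnit_det'.ne_zero)).ne'
  exact (mul_right_cancel₀ hne (mul_right_cancel₀ hne' (mul_right_cancel₀ hΦ h))).symm


/-! ## §2 The index of a real symmetric form `x ↦ e^{2πi xᵀ S x}` ([Weil1964, Chap. II n° 26, p. 173])

"toute forme quadratique non dégénérée est équivalente à une forme `q_a(x) - q_b(y)`": by an
orthogonal diagonalisation `S = U diag(λ) Uᵀ` (Mathlib's spectral theorem for Hermitian matrices) the
character of `q_S(x) = xᵀ S x` is `f_{diag λ} ∘ Uᵀ`, so §1 applies with `|det Uᵀ| = 1`. -/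

/-- the **second-degree character `f_S(x) = e^{2πi xᵀ S x}`** of the real quadratic form with Gram matrix
`S` (symmetric morphism `ρ = 2S`). [cite: Weil1964, Chap. II n° 26, p. 173] -/
def symmChirp (S : Matrix ι ι ℝ) (x : ι → ℝ) : ℂ := cexp (2 * π * I * ((x ⬝ᵥ S *ᵥ x : ℝ) : ℂ))

/-- unfolding. [cite: Weil1964, Chap. II n° 26, p. 173] -/
theorem symmChirp_apply (S : Matrix ι ι ℝ) (x : ι → ℝ) :
    symmChirp S x = cexp (2 * π * I * ((x ⬝ᵥ S *ᵥ x : ℝ) : ℂ)) := rfl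

/-- `|f_S(x)| = 1`. [cite: Weil1964, Chap. I n° 2, p. 146] -/
theorem norm_symmChirp (S : Matrix ι ι ℝ) (x : ι → ℝ) : ‖symmChirp S x‖ = 1 := by
  rw [symmChirp, show 2 * π * I * ((x ⬝ᵥ S *ᵥ x : ℝ) : ℂ) = ((2 * π * (x ⬝ᵥ S *ᵥ x) : ℝ) : ℂ) * I by
    push_cast; ring, Complex.norm_exp_ofReal_mul_I]

/-- a diagonal Gram matrix gives the diagonal character `∏ e^{2πi cᵢ xᵢ²}`. [cite: Weil1964, Chap. II n° 26, p. 173] -/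
theorem symmChirp_diagonal [DecidableEq ι] (c x : ι → ℝ) :
    symmChirp (Matrix.diagonal c) x = realChirpPi c x := by
  rw [symmChirp, realChirpPi_eq_cexp_sum]
  congr 1
  simp only [dotProduct, Matrix.mulVec_diagonal]
  push_cast
  rw [Finset.mul_sum, Finset.mul_sum]
  exact Finset.sum_congr rfl fun i _ => by ring

/-- **equivalent forms**: `f_{Pᵀ S P} = f_S ∘ P`. [cite: Weil1964, Chap. II n° 25, p. 173] -/
theorem symmChirp_transpose_mul_mul (S P : Matrix ι ι ℝ) (x : ι → ℝ) :
    symmChirp (Pᵀ * S * P) x = symmChirp S (P *ᵥ x) := by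
  rw [symmChirp, symmChirp, ← Matrix.mulVec_mulVec, ← Matrix.mulVec_mulVec, Matrix.dotProduct_mulVec,
    Matrix.vecMul_transpose]

/-- **orthogonal diagonalisation of the character**: for a symmetric `S` with eigenvalues `λ` and
orthonormal eigenvector matrix `U` (Mathlib's spectral theorem `S = U diag(λ) Uᵀ`),
`f_S = f_{diag λ} ∘ Uᵀ`. [cite: Weil1964, Chap. II n° 26, p. 173] -/
theorem symmChirp_eq_realChirpPi_eigenvalues [DecidableEq ι] {S : Matrix ι ι ℝ} (hS : S.IsHermitian)
    (x : ι → ℝ) :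
    symmChirp S x =
      realChirpPi hS.eigenvalues (((hS.eigenvectorUnitary : Matrix ι ι ℝ))ᵀ *ᵥ x) := by
  set U : Matrix ι ι ℝ := (hS.eigenvectorUnitary : Matrix ι ι ℝ) with hU
  have hstar : star U = Uᵀ := by
    rw [Matrix.star_eq_conjTranspose, Matrix.conjTranspose_eq_transpose_of_trivial]
  have hSd : S = (Uᵀ)ᵀ * Matrix.diagonal hS.eigenvalues * Uᵀ := by
    have h := hS.spectral_theorem
    have hre : (RCLike.ofReal ∘ hS.eigenvalues : ι → ℝ) = hS.eigenvalues := by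
      funext i
      simp
    rw [Unitary.conjStarAlgAut_apply, ← hU, hstar, hre] at h
    rw [Matrix.transpose_transpose]
    exact h
  conv_lhs => rw [hSd]
  rw [symmChirp_transpose_mul_mul, symmChirp_diagonal]

/-- **Weil's index of the real quadratic form with symmetric Gram matrix `S`**: the product of the
one-variable indices of its eigenvalues, `∏ᵢ e^{iπ sgn(λᵢ)/4} = e^{iπ (a - b)/4}` for the inertia `(a, b)`
("si `f` a le type d'inertie `(a, b)`, `γ(f) = γ(q₁)^{a-b}`"); §2 proves that it is the scalar of
Corollaire 2 for `f_S` (`weil_corollary2_symm`), which determines it (`realWeilIndexSymm_unique`) — in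
particular it does not depend on the chosen eigenbasis. [cite: Weil1964, Chap. II n° 26, pp. 173–174] -/
def realWeilIndexSymm [DecidableEq ι] {S : Matrix ι ι ℝ} (hS : S.IsHermitian) : ℂ :=
  realWeilIndexPi hS.eigenvalues

/-- unfolding. [cite: Weil1964, Chap. II n° 26, p. 173] -/
theorem realWeilIndexSymm_apply [DecidableEq ι] {S : Matrix ι ι ℝ} (hS : S.IsHermitian) :
    realWeilIndexSymm hS = realWeilIndexPi hS.eigenvalues := rfl

/-- `|γ(f_S)| = 1`. [cite: Weil1964, Chap. I n° 14 Thm 2, p. 161] -/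
theorem norm_realWeilIndexSymm [DecidableEq ι] {S : Matrix ι ι ℝ} (hS : S.IsHermitian) :
    ‖realWeilIndexSymm hS‖ = 1 :=
  norm_realWeilIndexPi _

/-- `γ(f_S)⁸ = 1`. [cite: Weil1964, Chap. II n° 26, p. 174] -/
theorem realWeilIndexSymm_pow_eight [DecidableEq ι] {S : Matrix ι ι ℝ} (hS : S.IsHermitian) :
    realWeilIndexSymm hS ^ 8 = 1 :=
  realWeilIndexPi_pow_eight _

/-- the eigenvalues of a non-degenerate symmetric form are nonzero. [folklore] -/
private theorem eigenvalues_ne_zero [DecidableEq ι] {S : Matrix ι ι ℝ} (hS : S.IsHermitian)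
    (hdet : S.det ≠ 0) (i : ι) : hS.eigenvalues i ≠ 0 := by
  rw [hS.det_eq_prod_eigenvalues] at hdet
  have := Finset.prod_ne_zero_iff.1 hdet i (Finset.mem_univ i)
  simpa using this

/-- **the inertia formula for `f_S`**: `γ(f_S) = γ(q₁)^a (γ(q₁)⁻¹)^b` where `(a, b)` is the number of
positive / negative eigenvalues of the invertible symmetric `S`. [cite: Weil1964, Chap. II n° 26, p. 173] -/
theorem realWeilIndexSymm_inertia [DecidableEq ι] {S : Matrix ι ι ℝ} (hS : S.IsHermitian)
    (hdet : S.det ≠ 0) :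
    realWeilIndexSymm hS =
      realWeilIndex 1 ^ (Finset.univ.filter fun i => 0 < hS.eigenvalues i).card *
        (realWeilIndex 1)⁻¹ ^ (Finset.univ.filter fun i => hS.eigenvalues i < 0).card :=
  realWeilIndexPi_inertia (eigenvalues_ne_zero hS hdet)

/-- an orthogonal matrix has `|det| = 1`. [folklore] -/
private theorem abs_det_eq_one_of_mem_unitaryGroup [DecidableEq ι] {U : Matrix ι ι ℝ}
    (hU : U ∈ Matrix.unitaryGroup ι ℝ) : |U.det| = 1 := by
  have h := (Unitary.mem_iff.1 (Matrix.det_of_mem_unitary hU)).1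
  rw [star_trivial] at h
  rcases mul_self_eq_one_iff.1 h with h1 | h1 <;> simp [h1]

/-- **Weil's Corollaire 2 for a non-degenerate real symmetric form**: for `S = Sᵀ` invertible and every
`Φ ∈ 𝓢(ℝ^ι)`, `∫∫ Φ(u) e^{2πi (x-u)ᵀ S (x-u)} du dx = γ(f_S) |det(2S)|^{-1/2} ∫ Φ` (`ρ = 2S`).
[cite: Weil1964, Chap. I n° 14 Cor. 2, p. 162; Chap. II n° 25–26, p. 173] -/
theorem weil_corollary2_symm [DecidableEq ι] {S : Matrix ι ι ℝ} (hS : S.IsHermitian) (hdet : S.det ≠ 0)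
    (Φ : 𝓢((ι → ℝ), ℂ)) :
    ∫ x : ι → ℝ, ∫ u : ι → ℝ, Φ u * symmChirp S (x - u) =
      realWeilIndexSymm hS * ((|((2 : ℝ) • S).det| ^ (-(1 / 2 : ℝ)) : ℝ) : ℂ) * ∫ x : ι → ℝ, Φ x := by
  set U : Matrix ι ι ℝ := (hS.eigenvectorUnitary : Matrix ι ι ℝ) with hU
  have hstar : star U = Uᵀ := by
    rw [Matrix.star_eq_conjTranspose, Matrix.conjTranspose_eq_transpose_of_trivial]
  have h1 : Uᵀ * U = 1 := by rw [← hstar]; exact Unitary.coe_star_mul_self hS.eigenvectorUnitary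
  have h2 : U * Uᵀ = 1 := by rw [← hstar]; exact Unitary.coe_mul_star_self hS.eigenvectorUnitary
  -- `T = Uᵀ` as a linear automorphism of `ℝ^ι`, `|det T| = 1`
  set T : (ι → ℝ) ≃ₗ[ℝ] (ι → ℝ) := LinearEquiv.ofLinear (Matrix.toLin' Uᵀ) (Matrix.toLin' U)
    (by rw [← Matrix.toLin'_mul, h1, Matrix.toLin'_one]) (by rw [← Matrix.toLin'_mul, h2, Matrix.toLin'_one])
    with hT
  have hTx : ∀ v : ι → ℝ, Uᵀ *ᵥ v = T v := fun v => by
    rw [hT, LinearEquiv.ofLinear_apply, Matrix.toLin'_apply]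
  have hTdet : |LinearMap.det (T : (ι → ℝ) →ₗ[ℝ] (ι → ℝ))| = 1 := by
    rw [hT, LinearEquiv.ofLinear_toLinearMap, LinearMap.det_toLin', Matrix.det_transpose]
    exact abs_det_eq_one_of_mem_unitaryGroup hS.eigenvectorUnitary.2
  have hev : ∀ i, hS.eigenvalues i ≠ 0 := eigenvalues_ne_zero hS hdet
  simp_rw [symmChirp_eq_realChirpPi_eigenvalues hS, ← hU, hTx]
  rw [weil_corollary2_pi_comp_linearEquiv hev T Φ, hTdet, inv_one, Complex.ofReal_one, mul_one,
    realWeilIndexSymm]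
  congr 2
  -- `∏ |2λᵢ|^{-1/2} = |det (2S)|^{-1/2}`
  rw [Matrix.det_smul, hS.det_eq_prod_eigenvalues, Real.finsetProd_rpow _ _ fun i _ => abs_nonneg _,
    ← Finset.abs_prod, Finset.prod_mul_distrib, Finset.prod_const, Finset.card_univ]
  simp

/-- **uniqueness / basis-independence**: any scalar `γ` satisfying Corollaire 2 for `f_S` and one Schwartz
`Φ` with `∫ Φ ≠ 0` equals `realWeilIndexSymm hS`. [cite: Weil1964, Chap. I n° 14 Thm 2 and Cor. 2, pp. 161–162] -/
theorem realWeilIndexSymm_unique [DecidableEq ι] {S : Matrix ι ι ℝ} (hS : S.IsHermitian) (hdet : S.det ≠ 0)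
    {γ : ℂ} (Φ : 𝓢((ι → ℝ), ℂ)) (hΦ : ∫ x, Φ x ≠ 0)
    (h : ∫ x : ι → ℝ, ∫ u : ι → ℝ, Φ u * symmChirp S (x - u) =
      γ * ((|((2 : ℝ) • S).det| ^ (-(1 / 2 : ℝ)) : ℝ) : ℂ) * ∫ x, Φ x) :
    γ = realWeilIndexSymm hS := by
  rw [weil_corollary2_symm hS hdet Φ] at h
  have hne : ((|((2 : ℝ) • S).det| ^ (-(1 / 2 : ℝ)) : ℝ) : ℂ) ≠ 0 := by
    have h2 : ((2 : ℝ) • S).det ≠ 0 := by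
      rw [Matrix.det_smul]
      exact mul_ne_zero (pow_ne_zero _ two_ne_zero) hdet
    exact_mod_cast (Real.rpow_pos_of_pos (abs_pos.2 h2) _).ne'
  exact (mul_right_cancel₀ hne (mul_right_cancel₀ hΦ h)).symm

/-! ## §3 The complex place for an arbitrary character ([Weil1964, Chap. II n° 26, p. 174])

For `k = C` the character is `χ(z) = χ₀(λz + λ̄z̄) = e^{4πi Re(λz)}` and the form `c z²`; with
`μ = λc = a + ib ≠ 0` and `z = x + iy`, `χ(cz²) = e^{2πi · 2Re(μ z²)} = e^{2πi (2a x² - 4b xy - 2a y²)}` is the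
character of the real symmetric Gram matrix `S_μ = [[2a, -2b], [-2b, -2a]]` on `R²`, of determinant
`-4|μ|² < 0`, hence of inertia `(1, 1)`: `γ = 1`. -/

/-- the Gram matrix on `R² = C` of the real form `2 Re(μ z²)`, `μ = a + ib`. [cite: Weil1964, Chap. II n° 26, p. 174] -/
def complexPlaceGram (μ : ℂ) : Matrix (Fin 2) (Fin 2) ℝ := !![2 * μ.re, -(2 * μ.im); -(2 * μ.im), -(2 * μ.re)]

/-- `S_μ` is symmetric. [cite: Weil1964, Chap. II n° 26, p. 174] -/
theorem isHermitian_complexPlaceGram (μ : ℂ) : (complexPlaceGram μ).IsHermitian := by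
  refine Matrix.IsHermitian.ext fun i j => ?_
  fin_cases i <;> fin_cases j <;> simp [complexPlaceGram]

/-- `det S_μ = -4|μ|²`. [cite: Weil1964, Chap. II n° 26, p. 174] -/
theorem det_complexPlaceGram (μ : ℂ) : (complexPlaceGram μ).det = -(4 * Complex.normSq μ) := by
  rw [complexPlaceGram, Matrix.det_fin_two_of, Complex.normSq_apply]
  ring

/-- the character of `S_μ` at `(x, y)` is Weil's `χ(c z²) = e^{2πi · 2 Re(μ z²)}`, `z = x + iy`, `μ = λ c`.
[cite: Weil1964, Chap. II n° 26, p. 174] -/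
theorem symmChirp_complexPlaceGram (μ : ℂ) (x y : ℝ) :
    symmChirp (complexPlaceGram μ) ![x, y] =
      cexp (2 * π * I * ((2 * (μ * ((x : ℂ) + (y : ℂ) * I) ^ 2).re : ℝ) : ℂ)) := by
  rw [symmChirp]
  congr 3
  simp [complexPlaceGram, Matrix.mulVec, dotProduct, Fin.sum_univ_two, Complex.mul_re, Complex.mul_im, sq]
  ring

/-- a diagonal binary form whose coefficients have opposite signs (inertia `(1, 1)`) has index `1`.
[cite: Weil1964, Chap. II n° 26, p. 174] -/
theorem realWeilIndexPi_eq_one_of_mul_neg {c : Fin 2 → ℝ} (h : c 0 * c 1 < 0) : realWeilIndexPi c = 1 := by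
  rw [realWeilIndexPi, Fin.prod_univ_two]
  rcases lt_or_gt_of_ne (show c 0 ≠ 0 from fun h0 => by rw [h0, zero_mul] at h; exact lt_irrefl _ h)
    with h0 | h0
  · have h1 : 0 < c 1 := by nlinarith
    rw [realWeilIndex_of_neg h0, realWeilIndex_of_pos h1, ← Complex.exp_add, neg_add_cancel, Complex.exp_zero]
  · have h1 : c 1 < 0 := by nlinarith
    rw [realWeilIndex_of_pos h0, realWeilIndex_of_neg h1, ← Complex.exp_add, add_neg_cancel, Complex.exp_zero]

/-- **`γ = 1` at the complex place** for every character `χ(z) = χ₀(λz + λ̄z̄)` and every non-degenerate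
form `c z²` (`μ = λc ≠ 0`): "Il en est donc de même pour toute forme quadratique non dégénérée sur `C`".
[cite: Weil1964, Chap. II n° 26, p. 174] -/
theorem realWeilIndexSymm_complexPlaceGram {μ : ℂ} (hμ : μ ≠ 0) :
    realWeilIndexSymm (isHermitian_complexPlaceGram μ) = 1 := by
  have hdet : (complexPlaceGram μ).det < 0 := by
    rw [det_complexPlaceGram]
    exact neg_neg_of_pos (mul_pos four_pos (Complex.normSq_pos.2 hμ))
  refine realWeilIndexPi_eq_one_of_mul_neg ?_
  have h := (isHermitian_complexPlaceGram μ).det_eq_prod_eigenvalues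
  rw [Fin.prod_univ_two] at h
  simp only [RCLike.ofReal_real_eq_id, id_eq] at h
  rwa [h] at hdet


/-! ## §4 Corollaire 2 on `C` with its Lebesgue measure ([Weil1964, Chap. II n° 26, p. 174]) -/

/-- integrals over `ℂ` are integrals over `Fin 2 → ℝ` through `z = p₀ + i p₁` (Lebesgue measure on `ℂ = ℝ²`).
[folklore] -/
private theorem integral_complex_eq_pi {E : Type*} [NormedAddCommGroup E] [NormedSpace ℝ E] (F : ℂ → E) :
    ∫ z, F z = ∫ p : Fin 2 → ℝ, F (Complex.measurableEquivPi.symm p) :=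
  ((Complex.volume_preserving_equiv_pi.symm _).integral_comp
    Complex.measurableEquivPi.symm.measurableEmbedding F).symm

/-- the character of `S_μ` at `p` is `e^{2πi · 2 Re(μ z²)}` with `z = p₀ + i p₁`. [cite: Weil1964, Chap. II n° 26, p. 174] -/
private theorem symmChirp_complexPlaceGram_pi (μ : ℂ) (p : Fin 2 → ℝ) :
    symmChirp (complexPlaceGram μ) p =
      cexp (2 * π * I * ((2 * (μ * (Complex.measurableEquivPi.symm p) ^ 2).re : ℝ) : ℂ)) := by
  have h := symmChirp_complexPlaceGram μ (p 0) (p 1)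
  have hp : ![p 0, p 1] = p := by
    ext i
    fin_cases i <;> rfl
  rw [hp] at h
  rw [h, Complex.measurableEquivPi_symm_apply]

/-- **Weil's Corollaire 2 at the complex place, with `γ = 1`**: for the character
`χ(z) = χ₀(λz + λ̄z̄) = e^{4πi Re(λz)}` of `C`, the form `c z²` (`μ = λc ≠ 0`, `χ(cz²) = e^{2πi · 2Re(μz²)}`) and
Lebesgue measure on `C = R²`: for every `Φ ∈ 𝓢(C)`, `∫∫ Φ(u) χ(c(z - u)²) du dz = (4|μ|)⁻¹ ∫ Φ` — the scalar is
the positive module factor `|ρ|^{-1/2} = |det 2S_μ|^{-1/2}` alone: "`γ(f) = 1` ... pour toute forme quadratique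
non dégénérée sur `C`". [cite: Weil1964, Chap. II n° 26, p. 174; Chap. I n° 14 Cor. 2, p. 162] -/
theorem weil_corollary2_complexPlace {μ : ℂ} (hμ : μ ≠ 0) (Φ : 𝓢(ℂ, ℂ)) :
    ∫ z : ℂ, ∫ u : ℂ, Φ u * cexp (2 * π * I * ((2 * (μ * (z - u) ^ 2).re : ℝ) : ℂ)) =
      (((4 * ‖μ‖)⁻¹ : ℝ) : ℂ) * ∫ z : ℂ, Φ z := by
  set e : ℂ ≃L[ℝ] (Fin 2 → ℝ) := Complex.basisOneI.equivFun.toContinuousLinearEquiv with he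
  have hme : ∀ p, Complex.measurableEquivPi.symm p = e.symm p := fun p => rfl
  -- `Ψ = Φ ∘ e⁻¹ ∈ 𝓢(ℝ²)`
  set Ψ : 𝓢((Fin 2 → ℝ), ℂ) := SchwartzMap.compCLMOfContinuousLinearEquiv ℂ e.symm Φ with hΨ
  have hΨ_apply : ∀ p, Ψ p = Φ (Complex.measurableEquivPi.symm p) := fun p => rfl
  have hdet : (complexPlaceGram μ).det ≠ 0 := by
    rw [det_complexPlaceGram]
    exact neg_ne_zero.2 (mul_ne_zero four_ne_zero (Complex.normSq_pos.2 hμ).ne')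
  have key := weil_corollary2_symm (isHermitian_complexPlaceGram μ) hdet Ψ
  have hsub : ∀ x u : Fin 2 → ℝ, Complex.measurableEquivPi.symm (x - u) =
      Complex.measurableEquivPi.symm x - Complex.measurableEquivPi.symm u := fun x u => by
    rw [hme, hme, hme, map_sub]
  simp_rw [symmChirp_complexPlaceGram_pi, hΨ_apply, hsub, realWeilIndexSymm_complexPlaceGram hμ, one_mul]
    at key
  rw [integral_complex_eq_pi]
  simp_rw [integral_complex_eq_pi (fun u => Φ u * _)]
  rw [key, ← integral_complex_eq_pi (fun z => Φ z)]
  congr 1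
  -- `|det (2 S_μ)|^{-1/2} = (4|μ|)⁻¹`
  have h4 : 0 ≤ 4 * ‖μ‖ := by positivity
  rw [Matrix.det_smul, det_complexPlaceGram, Fintype.card_fin, Complex.normSq_eq_norm_sq,
    show |(2 : ℝ) ^ 2 * -(4 * ‖μ‖ ^ 2)| = (4 * ‖μ‖) ^ (2 : ℝ) by
      rw [Real.rpow_two, abs_of_nonpos (by nlinarith [sq_nonneg ‖μ‖])]; ring,
    ← Real.rpow_mul h4, show (2 : ℝ) * -(1 / 2) = -1 by norm_num, Real.rpow_neg_one]

end Literature.NumberTheory.Weil1964
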